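import Summits.Ventures.LatticeQCDFlow.Scoring.SU2PlaquetteSeriesFubini
import HarnessLib

/-!
# SU(2): term-by-term integration of the character expansion AGAINST A BOUNDED OBSERVABLE

HONEST FRAMING: exact (Metropolis-corrected) sampling algorithms for lattice gauge theory;
figures of merit are autocorrelation/cost numbers at stated couplings and volumes; no
continuum-physics claim.

Venture `LatticeQCDFlow` (cell pub-lqcd), sub-topic `Scoring`; FANOUT row 5 (`s0-sun-a`), GEN-10.
NEW WORK of the cell (placement rule).  GEN-9's `SU2PlaquetteSeriesFubini.integral_prod_plaqWeight_eq_tsum`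
integrates the character expansion of the product of Wilson plaquette weights term by term; for
EXPECTATIONS (the plaquette `⟨½ tr U_p⟩`, Wilson loops) one needs the same with an observable inserted:

* **`integral_mul_prod_plaqWeight_eq_tsum`** — on a probability space, for measurable
  `a : Fin F → Ω → [−1,1]`, a measurable observable `g` with `|g| ≤ 1` and `β ≥ 0`:
  `∫ g · ∏_p e^{−β(2−2a_p)} dμ = Σ'_{x : Fin F → ℕ} (∏_p c_{x_p}(β)) · ∫ g · ∏_p U_{x_p}(a_p) dμ`,
  the series converging absolutely (same domination `(Σ_n (n+1)c_n)^F` as without `g`);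
* `integral_mul_prod_plaqWeight_eq_tsum_fintype` — the same for an arbitrary finite index type of
  plaquettes.

Elementary given GEN-9's pointwise product expansion; nothing is cited; no `def`.
-/

noncomputable section

open Real MeasureTheory Set Filter Topology Finset Polynomial.Chebyshev
open Literature.MathematicalPhysics.QuantumFieldTheory Literature.MathematicalPhysics.QuantumLattice
open Literature.Analysis.FunctionSpaces
open Summit.Ventures.LatticeQCDFlow.Exactness

namespace Summit.Ventures.LatticeQCDFlow.Scoring

/-- **Fubini for the character expansion against a bounded observable.**  On a probability space,
for measurable `a : Fin F → Ω → ℝ` with values in `[−1, 1]`, a measurable `g : Ω → ℝ` with `|g| ≤ 1`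
and `β ≥ 0`:
`∫ g · ∏_p e^{−β(2−2a_p)} dμ = Σ'_{x : Fin F → ℕ} (∏_p c_{x_p}(β)) · ∫ g · ∏_p U_{x_p}(a_p) dμ`,
and the series on the right converges absolutely. -/
theorem integral_mul_prod_plaqWeight_eq_tsum {Ω : Type*} [MeasurableSpace Ω] (μ : Measure Ω)
    [IsProbabilityMeasure μ] {β : ℝ} (hβ : 0 ≤ β) {F : ℕ} (a : Fin F → Ω → ℝ)
    (ham : ∀ p, Measurable (a p)) (ha : ∀ p ω, a p ω ∈ Icc (-1 : ℝ) 1)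
    (g : Ω → ℝ) (hgm : Measurable g) (hg : ∀ ω, |g ω| ≤ 1) :
    (Summable fun x : Fin F → ℕ => (∏ p, Real.exp (-(2 * β)) *
        (besselI (x p) (2 * β) - besselI (x p + 2) (2 * β))) *
        ∫ ω, g ω * ∏ p, (U ℝ (x p)).eval (a p ω) ∂μ) ∧
    ∫ ω, g ω * ∏ p, Real.exp (-(β * (2 - 2 * a p ω))) ∂μ =
      ∑' x : Fin F → ℕ, (∏ p, Real.exp (-(2 * β)) *
        (besselI (x p) (2 * β) - besselI (x p + 2) (2 * β))) *
        ∫ ω, g ω * ∏ p, (U ℝ (x p)).eval (a p ω) ∂μ := by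
  set c : ℕ → ℝ := fun n => Real.exp (-(2 * β)) * (besselI n (2 * β) - besselI (n + 2) (2 * β)) with hc
  set d : ℕ → ℝ := fun n => ((n : ℝ) + 1) * (Real.exp (-(2 * β)) * besselI n (2 * β)) with hd
  -- the terms G x ω = g ω · ∏_p c_{x_p} U_{x_p}(a_p ω), bounded by D x = ∏_p d_{x_p}
  have hGm : ∀ x : Fin F → ℕ, Measurable fun ω => g ω * ∏ p, c (x p) * (U ℝ (x p)).eval (a p ω) := by
    intro x
    refine hgm.mul (Finset.measurable_prod _ fun p _ => ?_)
    exact measurable_const.mul ((U ℝ (x p)).continuous.measurable.comp (ham p))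
  have hGb : ∀ (x : Fin F → ℕ) (ω : Ω), ‖g ω * ∏ p, c (x p) * (U ℝ (x p)).eval (a p ω)‖ ≤ ∏ p, d (x p) := by
    intro x ω
    rw [norm_mul, norm_prod]
    have h1 : ‖g ω‖ ≤ 1 := by rw [Real.norm_eq_abs]; exact hg ω
    have h2 : ∏ p, ‖c (x p) * (U ℝ (x p)).eval (a p ω)‖ ≤ ∏ p, d (x p) :=
      Finset.prod_le_prod (fun p _ => norm_nonneg _)
        fun p _ => norm_charCoeff_mul_chebyshevU_le hβ (x p) (ha p ω)
    have h3 : 0 ≤ ∏ p, ‖c (x p) * (U ℝ (x p)).eval (a p ω)‖ := Finset.prod_nonneg fun p _ => norm_nonneg _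
    calc ‖g ω‖ * ∏ p, ‖c (x p) * (U ℝ (x p)).eval (a p ω)‖
        ≤ 1 * ∏ p, ‖c (x p) * (U ℝ (x p)).eval (a p ω)‖ := mul_le_mul_of_nonneg_right h1 h3
      _ ≤ ∏ p, d (x p) := by rw [one_mul]; exact h2
  have hDs : Summable fun x : Fin F → ℕ => ∏ p, d (x p) :=
    (tsum_prod_pi_eq_prod_tsum_of_nonneg (fun _ : Fin F => d)
      (fun _ n => by have := besselI_nonneg n (show 0 ≤ 2 * β by linarith); positivity)
      (fun _ => summable_succ_mul_exp_mul_besselI hβ)).1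
  have hGi : ∀ x : Fin F → ℕ, Integrable (fun ω => g ω * ∏ p, c (x p) * (U ℝ (x p)).eval (a p ω)) μ :=
    fun x => Integrable.mono' (integrable_const (∏ p, d (x p))) (hGm x).aestronglyMeasurable
      (Eventually.of_forall (hGb x))
  have hnorm : Summable fun x : Fin F → ℕ => ∫ ω, ‖g ω * ∏ p, c (x p) * (U ℝ (x p)).eval (a p ω)‖ ∂μ := by
    refine Summable.of_nonneg_of_le (fun x => integral_nonneg fun ω => norm_nonneg _) (fun x => ?_) hDs
    calc ∫ ω, ‖g ω * ∏ p, c (x p) * (U ℝ (x p)).eval (a p ω)‖ ∂μ ≤ ∫ _ω, ∏ p, d (x p) ∂μ :=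
          integral_mono_of_nonneg (Eventually.of_forall fun ω => norm_nonneg _) (integrable_const _)
            (Eventually.of_forall (hGb x))
      _ = ∏ p, d (x p) := by rw [MeasureTheory.integral_const, probReal_univ, one_smul]
  -- pointwise expansion (times `g ω`), then exchange ∫ and Σ'
  have hpt : ∀ ω, g ω * ∏ p, Real.exp (-(β * (2 - 2 * a p ω))) =
      ∑' x : Fin F → ℕ, g ω * ∏ p, c (x p) * (U ℝ (x p)).eval (a p ω) := by
    intro ω
    rw [(prod_plaqWeight_eq_tsum hβ (fun p => a p ω) (fun p => ha p ω)).2, ← tsum_mul_left]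
  have hswap := integral_tsum_of_summable_integral_norm hGi hnorm
  -- the constants come out of each integral
  have hterm : ∀ x : Fin F → ℕ, ∫ ω, g ω * ∏ p, c (x p) * (U ℝ (x p)).eval (a p ω) ∂μ =
      (∏ p, c (x p)) * ∫ ω, g ω * ∏ p, (U ℝ (x p)).eval (a p ω) ∂μ := by
    intro x
    rw [← MeasureTheory.integral_const_mul]
    refine integral_congr_ae (Eventually.of_forall fun ω => ?_)
    simp only [Finset.prod_mul_distrib]
    ring
  simp_rw [hpt, ← hswap, hterm]
  refine ⟨?_, rfl⟩
  refine Summable.of_norm_bounded hDs fun x => ?_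
  rw [← hterm]
  exact (norm_integral_le_integral_norm _).trans
    ((integral_mono_of_nonneg (Eventually.of_forall fun ω => norm_nonneg _) (integrable_const _)
      (Eventually.of_forall (hGb x))).trans_eq
      (by rw [MeasureTheory.integral_const, probReal_univ, one_smul]))

/-- The same for an arbitrary finite index type of plaquettes. -/
theorem integral_mul_prod_plaqWeight_eq_tsum_fintype {Ω : Type*} [MeasurableSpace Ω] (μ : Measure Ω)
    [IsProbabilityMeasure μ] {β : ℝ} (hβ : 0 ≤ β) {ι : Type*} [Fintype ι] (a : ι → Ω → ℝ)
    (ham : ∀ p, Measurable (a p)) (ha : ∀ p ω, a p ω ∈ Icc (-1 : ℝ) 1)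
    (g : Ω → ℝ) (hgm : Measurable g) (hg : ∀ ω, |g ω| ≤ 1) :
    (Summable fun x : ι → ℕ => (∏ p, Real.exp (-(2 * β)) *
        (besselI (x p) (2 * β) - besselI (x p + 2) (2 * β))) *
        ∫ ω, g ω * ∏ p, (U ℝ (x p)).eval (a p ω) ∂μ) ∧
    ∫ ω, g ω * ∏ p, Real.exp (-(β * (2 - 2 * a p ω))) ∂μ =
      ∑' x : ι → ℕ, (∏ p, Real.exp (-(2 * β)) *
        (besselI (x p) (2 * β) - besselI (x p + 2) (2 * β))) *
        ∫ ω, g ω * ∏ p, (U ℝ (x p)).eval (a p ω) ∂μ := by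
  classical
  set e : ι ≃ Fin (Fintype.card ι) := Fintype.equivFin ι with he
  have hfin := integral_mul_prod_plaqWeight_eq_tsum μ hβ (fun j => a (e.symm j)) (fun j => ham _)
    (fun j ω => ha _ ω) g hgm hg
  set Φ : (ι → ℕ) ≃ (Fin (Fintype.card ι) → ℕ) := Equiv.piCongrLeft' (fun _ : ι => ℕ) e with hΦ
  set T : (Fin (Fintype.card ι) → ℕ) → ℝ := fun y => (∏ j, Real.exp (-(2 * β)) *
      (besselI (y j) (2 * β) - besselI (y j + 2) (2 * β))) *
      ∫ ω, g ω * ∏ j, (U ℝ (y j)).eval (a (e.symm j) ω) ∂μ with hT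
  have hTΦ : ∀ x : ι → ℕ, T (Φ x) = (∏ p, Real.exp (-(2 * β)) *
      (besselI (x p) (2 * β) - besselI (x p + 2) (2 * β))) *
      ∫ ω, g ω * ∏ p, (U ℝ (x p)).eval (a p ω) ∂μ := by
    intro x
    have h1 : (∏ j, Real.exp (-(2 * β)) * (besselI (Φ x j) (2 * β) - besselI (Φ x j + 2) (2 * β))) =
        ∏ p, Real.exp (-(2 * β)) * (besselI (x p) (2 * β) - besselI (x p + 2) (2 * β)) :=
      e.symm.prod_comp (fun p => Real.exp (-(2 * β)) * (besselI (x p) (2 * β) - besselI (x p + 2) (2 * β)))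
    have h2 : ∀ ω, (∏ j, (U ℝ (Φ x j)).eval (a (e.symm j) ω)) = ∏ p, (U ℝ (x p)).eval (a p ω) :=
      fun ω => e.symm.prod_comp (fun p => (U ℝ (x p)).eval (a p ω))
    rw [hT]
    simp only
    rw [h1]
    simp_rw [h2]
  have hprodw : ∀ ω, (∏ j, Real.exp (-(β * (2 - 2 * a (e.symm j) ω)))) =
      ∏ p, Real.exp (-(β * (2 - 2 * a p ω))) :=
    fun ω => e.symm.prod_comp (fun p => Real.exp (-(β * (2 - 2 * a p ω))))
  simp_rw [hprodw] at hfin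
  obtain ⟨hs, hi⟩ := hfin
  refine ⟨?_, ?_⟩
  · have : Summable (T ∘ Φ) := (Φ.summable_iff (f := T)).mpr hs
    refine this.congr fun x => ?_
    rw [Function.comp_apply, hTΦ]
  · rw [hi, ← Φ.tsum_eq]
    exact tsum_congr fun x => hTΦ x

end Summit.Ventures.LatticeQCDFlow.Scoring
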